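import Literature.NumberTheory.Weil1965.SplitPlaceSliceDensity
import Mathlib.MeasureTheory.Integral.DominatedConvergence
import HarnessLib

/-!
# Fibre densities of the split hermitian form `h(x, y) = x ⬝ᵥ y` over a non-archimedean local field
# (Weil's local measures `|θ_b|_v` at a place SPLIT in `E/F`: [Weil1965] n° 37 Prop. 6, n° 44 Thm 2, n° 50 (40))

Topic `NumberTheory/Weil1965`; namespace `Literature.NumberTheory.Weil1965.SplitPlace`. KERNEL mathematics only
(definitions with bodies + theorems; no named fact, no `axiom`, no `sorry`). Sequel of `SplitPlaceSliceDensity.lean`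
(levels, the plateau lemma, slice densities `sliceDensity μ x f b` of the linear fibration `y ↦ x ⬝ᵥ y`, the level
weight `levelWeight μ ℓ` and its integrability for `|ι| ≥ 2`).

SETTING. `K` a non-archimedean local field with additive Haar measure `μ`, `ι` finite with `2 ≤ |ι|`, `X = K^ι × K^ι`
with `μ^ι ⊗ μ^ι`, and the SPLIT FORM `h(x, y) = x ⬝ᵥ y`. At a finite place `v` of `F` split in the CM extension `E/F`:
`E_v = F_v × F_v`, `V_v = F_vᴺ × F_vᴺ` with `(x, y) ↦ Σ dᵢ xᵢ yᵢ ≃ x ⬝ᵥ y`, `U(V)(F_v) ≅ GL_N(F_v)` acting by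
`(x, y) ↦ (g x, g⁻ᵀ y)` — the place at which Weil's uniqueness theorem [Weil1965, Chap. V n° 50 Thm 4, (39)–(40)] is run
on the E2-SW child line of crux H413 (E-2 lead finding `E2-SW2c-FINDING.v0` §2 (v)–(vii); census
`SW2-IDENTITY-CENSUS.v0` §4 I-SPLIT; F0P4-plan (g3) re-deal 2026-08-31T01:10Z, row «FILE A»).

WHAT IS HERE (all proved). For a Schwartz–Bruhat (locally constant, compactly supported) `Φ : X → ℂ`:
* the FIBRE AVERAGES `fibreAvg μ Φ b r = μ(𝔭^r)⁻¹ ∫_X 𝟙_{b+𝔭^r}(x ⬝ᵥ y) Φ(x, y)` and the FIBRE DENSITY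
  `fibreDensity μ Φ b = ∫_{K^ι} sliceDensity μ x (Φ(x, ·)) b dμ^ι(x)`;
* `exists_structure_of_mem_schwartzBruhat` — invariance of `Φ` under a product of boxes, support in a product of
  boxes, uniform bound; `fibreAvg_eq_integral_sliceAvg` (Fubini);
* **`tendsto_fibreAvg`** — `fibreAvg μ Φ b r → fibreDensity μ Φ b` as `r → ∞` for EVERY `b ∈ K`, including the cone
  value `b = 0` (dominated convergence in `x` against `M · levelWeight`, integrable iff `|ι| ≥ 2`): Weil's fibre measure
  `|θ_b|_v(Φ)` [Weil1965, n° 44 Thm 2] EXISTS at a split place as the limit of the slab averages;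
* **`continuous_fibreDensity`** — `b ↦ fibreDensity μ Φ b` is continuous on ALL of `K` [Weil1965, n° 37 Prop. 6 p. 54]
  (for `b ∈ b₀ + 𝔭^m` the slice densities agree at every `x` of level `≤ m - ℓ`; the rest is a tail
  `2M ∫_{(𝔭^{m+1-ℓ})^ι} levelWeight → 0`, the boxes shrinking to the null point `0`);
* **`integral_mul_comp_dotProduct`** — DISINTEGRATION `∫_X Φ(x,y) g(x ⬝ᵥ y) d(μ^ι ⊗ μ^ι) = ∫_K g(b) fibreDensity μ Φ b dμ(b)`
  for Schwartz–Bruhat `g` on `K`: `fibreDensity` IS the continuous density of `h_*(Φ dμ^ι ⊗ dμ^ι)` w.r.t. `μ` (with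
  `g = ψ(b* ·) 𝟙_{ball}` this is Weil's `F*_Φ = 𝓕 F_Φ`, the input of the Poisson step on `𝔸_F/F`);
* **`re_fibreDensity_indicator_zero_pos`**, `fibreDensity_indicator_zero_ne_zero` — for `Φ₀ = 𝟙_{𝒪^ι × 𝒪^ι}`,
  `Re F_{Φ₀}(0) ≥ μ^ι(𝒪^ι)²/μ(𝒪) > 0` (exact slice value `sliceDensity_indicator_zero`): the cone `x ⬝ᵥ y = 0` has
  positive density — `U(0)_v ≠ ∅`, the last input of Weil's one-place argument [Weil1965, n° 50, p. 74: "on peut donc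
  choisir `Φ_v` de manière que `μ_v(0)` ne soit pas nul"].

NOT here (sibling rows of the E2-SW table): invariance under `(x, y) ↦ (g x, g⁻ᵀ y)` and homogeneity under
`(x, y) ↦ (t x, t' y)` (row SW2c-SCAL: change variables in `fibreAvg` with ★ `LocalLinearChangeOfVariables`, pass to the
limit with `tendsto_fibreAvg`), the uniqueness of `GL_N(K)`-invariant measures on the fibres (row I-UNIQ, ★
`MeasureTheory/Group/InvariantQuotientUniqueness`), and the non-split places (row (G1) finite-generic).

## References

* [Weil1965] A. Weil, *Sur la formule de Siegel dans la théorie des groupes classiques*, Acta Math. 113 (1965) 1–87: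
  Chap. III n° 37 Prop. 6 p. 54 (continuity of `i ↦ F_Φ(i)`), Chap. IV n° 44 Thm 2 p. 63 (the measures
  `μ_i = |θ_i|_A`), Chap. V n° 49 Lemma 22 p. 70, n° 50 Thm 4 (39)–(40) pp. 72–74 (the one-place scaling argument).
* [WeilBNT1967] A. Weil, *Basic Number Theory* (1967), Ch. I §2 (modules), Ch. II §2 (boxes), Ch. VII §2 (standard functions).
-/

noncomputable section

namespace Literature.NumberTheory.Weil1965.SplitPlace

open _root_.MeasureTheory _root_.Filter _root_.Set Literature.NumberTheory.Automorphic
open Literature.NumberTheory.Automorphic.LocalFieldHaar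
open scoped Topology Pointwise NNReal ENNReal
open Literature.NumberTheory.GaloisRepresentations.IsNonarchimedeanLocalField

variable {K : Type*} [Field K] [ValuativeRel K] [TopologicalSpace K] [IsNonarchimedeanLocalField K]
variable {ι : Type*}

/-! ## §4 The fibre density of `h(x, y) = x ⬝ᵥ y` on `X = K^ι × K^ι` and the convergence of the fibre averages -/

section FibreDensity

variable [Fintype ι] [MeasurableSpace K] [BorelSpace K] (μ : Measure K) [μ.IsAddHaarMeasure]

/-- **the fibre averages** `A_r(Φ; b) = μ(𝔭^r)⁻¹ ∫_X 𝟙_{b+𝔭^r}(x ⬝ᵥ y) Φ(x, y) d(μ^ι ⊗ μ^ι)` — the mass of `Φ` on the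
shrinking slabs `{h ∈ b + 𝔭^r}` of the split form `h(x,y) = x ⬝ᵥ y`, normalised by the measure of the base ball.
[cite: Weil1965, Chap. IV n° 44 Thm 2, p. 63] -/
def fibreAvg (Φ : (ι → K) × (ι → K) → ℂ) (b : K) (r : ℤ) : ℂ :=
  (μ.real (primePowBall K r) : ℂ)⁻¹ *
    ∫ z, (b +ᵥ primePowBall K r).indicator (1 : K → ℂ) (z.1 ⬝ᵥ z.2) * Φ z
      ∂((Measure.pi fun _ : ι => μ).prod (Measure.pi fun _ : ι => μ))

/-- **the fibre density** `F_Φ(b) = ∫_{K^ι} s(x, Φ(x, ·); b) dμ^ι(x)` of the split form `h(x, y) = x ⬝ᵥ y`: the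
`x`-integral of the slice densities — Weil's local measure `|θ_b|_v(Φ)` at a split place; the limit of the fibre
averages (`tendsto_fibreAvg`) and the density of `h_*(Φ dx dy)` (`integral_mul_comp_dotProduct`).
[cite: Weil1965, Chap. IV n° 44 Thm 2, p. 63] -/
def fibreDensity [Nonempty ι] (Φ : (ι → K) × (ι → K) → ℂ) (b : K) : ℂ :=
  ∫ x, sliceDensity μ x (fun y => Φ (x, y)) b ∂(Measure.pi fun _ : ι => μ)

omit [MeasurableSpace K] [BorelSpace K] in
/-- nhds of `0` in `K^ι × K^ι` contain a product of boxes. [cite: WeilBNT1967, Ch. II §1, Prop. 1] -/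
theorem exists_box_prod_box_subset_of_mem_nhds_zero {W : Set ((ι → K) × (ι → K))}
    (hW : W ∈ 𝓝 (0 : (ι → K) × (ι → K))) :
    ∃ N : ℕ, piPrimePowBall K ι (N : ℤ) ×ˢ piPrimePowBall K ι (N : ℤ) ⊆ W := by
  rw [show (0 : (ι → K) × (ι → K)) = ((0 : ι → K), (0 : ι → K)) from rfl, mem_nhds_prod_iff] at hW
  obtain ⟨u, hu, v, hv, huv⟩ := hW
  obtain ⟨N₁, hN₁⟩ := exists_piPrimePowBall_subset_of_mem_nhds_zero hu
  obtain ⟨N₂, hN₂⟩ := exists_piPrimePowBall_subset_of_mem_nhds_zero hv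
  refine ⟨max N₁ N₂, fun z hz => huv ⟨hN₁ ?_, hN₂ ?_⟩⟩
  · exact piPrimePowBall_antitone (by exact_mod_cast le_max_left N₁ N₂) hz.1
  · exact piPrimePowBall_antitone (by exact_mod_cast le_max_right N₁ N₂) hz.2

omit [MeasurableSpace K] [BorelSpace K] in
/-- **structure of Schwartz–Bruhat functions on `K^ι × K^ι`**: invariance under a product of boxes `(𝔭^ℓ)^ι × (𝔭^ℓ)^ι`,
support in a product of boxes `(𝔭^{n₀})^ι × (𝔭^{n₀})^ι`, and a uniform bound (locally constant + compact support).
[cite: WeilBNT1967, Ch. VII §2, Prop. 2] -/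
theorem exists_structure_of_mem_schwartzBruhat {Φ : (ι → K) × (ι → K) → ℂ}
    (hΦ : Φ ∈ SchwartzBruhat ((ι → K) × (ι → K))) :
    ∃ (ℓ n₀ : ℤ) (A : ℝ), (∀ z, ∀ t ∈ piPrimePowBall K ι ℓ ×ˢ piPrimePowBall K ι ℓ, Φ (z + t) = Φ z) ∧
      (∀ z, z ∉ piPrimePowBall K ι n₀ ×ˢ piPrimePowBall K ι n₀ → Φ z = 0) ∧ (∀ z, ‖Φ z‖ ≤ A) := by
  obtain ⟨hlc, hcs⟩ := (mem_schwartzBruhat_iff).1 hΦ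
  -- local invariance at each point
  have hloc : ∀ z : (ι → K) × (ι → K), ∃ n : ℕ,
      ∀ t ∈ piPrimePowBall K ι (n : ℤ) ×ˢ piPrimePowBall K ι (n : ℤ), Φ (z + t) = Φ z := by
    intro z
    have h1 : {w | Φ w = Φ z} ∈ 𝓝 z := (hlc.isOpen_fiber (Φ z)).mem_nhds rfl
    have h2 : (fun t => z + t) ⁻¹' {w | Φ w = Φ z} ∈ 𝓝 (0 : (ι → K) × (ι → K)) :=
      (continuous_const.add continuous_id).continuousAt.preimage_mem_nhds (by simpa using h1)
    obtain ⟨n, hn⟩ := exists_box_prod_box_subset_of_mem_nhds_zero h2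
    exact ⟨n, fun t ht => hn ht⟩
  choose n hn using hloc
  set S := tsupport Φ with hS
  have hopen : ∀ z : (ι → K) × (ι → K), ∀ N : ℤ, IsOpen (z +ᵥ piPrimePowBall K ι N ×ˢ piPrimePowBall K ι N) :=
    fun z N => ((isOpen_piPrimePowBall N).prod (isOpen_piPrimePowBall N)).vadd z
  have hself : ∀ z : (ι → K) × (ι → K), ∀ N : ℤ, z ∈ z +ᵥ piPrimePowBall K ι N ×ˢ piPrimePowBall K ι N :=
    fun z N => ⟨0, ⟨zero_mem_piPrimePowBall N, zero_mem_piPrimePowBall N⟩, by simp⟩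
  have hU : ∀ z ∈ S, z +ᵥ piPrimePowBall K ι (n z : ℤ) ×ˢ piPrimePowBall K ι (n z : ℤ) ∈ 𝓝 z := fun z _ =>
    (hopen z _).mem_nhds (hself z _)
  obtain ⟨s, -, hs⟩ := hcs.elim_nhds_subcover (fun z => z +ᵥ piPrimePowBall K ι (n z : ℤ) ×ˢ piPrimePowBall K ι (n z : ℤ)) hU
  set N : ℕ := s.sup n with hN
  have hbox : ∀ M M' : ℤ, M ≤ M' → piPrimePowBall K ι M' ×ˢ piPrimePowBall K ι M' ⊆
      piPrimePowBall K ι M ×ˢ piPrimePowBall K ι M := fun M M' h =>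
    Set.prod_mono (piPrimePowBall_antitone h) (piPrimePowBall_antitone h)
  have hadd : ∀ M : ℤ, ∀ t t' : (ι → K) × (ι → K), t ∈ piPrimePowBall K ι M ×ˢ piPrimePowBall K ι M →
      t' ∈ piPrimePowBall K ι M ×ˢ piPrimePowBall K ι M → t + t' ∈ piPrimePowBall K ι M ×ˢ piPrimePowBall K ι M :=
    fun M t t' ht ht' => ⟨add_mem_piPrimePowBall ht.1 ht'.1, add_mem_piPrimePowBall ht.2 ht'.2⟩
  have hneg : ∀ M : ℤ, ∀ t : (ι → K) × (ι → K), t ∈ piPrimePowBall K ι M ×ˢ piPrimePowBall K ι M →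
      -t ∈ piPrimePowBall K ι M ×ˢ piPrimePowBall K ι M :=
    fun M t ht => ⟨neg_mem_piPrimePowBall ht.1, neg_mem_piPrimePowBall ht.2⟩
  have step1 : ∀ z ∈ S, ∀ t ∈ piPrimePowBall K ι (N : ℤ) ×ˢ piPrimePowBall K ι (N : ℤ), Φ (z + t) = Φ z := by
    intro z hz t ht
    obtain ⟨a, ha, hza⟩ := Set.mem_iUnion₂.1 (hs hz)
    obtain ⟨k, hk, rfl⟩ := Set.mem_vadd_set.1 hza
    have hNa : piPrimePowBall K ι (N : ℤ) ×ˢ piPrimePowBall K ι (N : ℤ) ⊆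
        piPrimePowBall K ι (n a : ℤ) ×ˢ piPrimePowBall K ι (n a : ℤ) :=
      hbox _ _ (by exact_mod_cast Finset.le_sup ha)
    rw [vadd_eq_add, add_assoc, hn a _ (hadd _ _ _ hk (hNa ht)), hn a _ hk]
  -- support
  have hcover : S ⊆ ⋃ k : ℕ, piPrimePowBall K ι (-(k : ℤ)) ×ˢ piPrimePowBall K ι (-(k : ℤ)) := by
    intro z _
    obtain ⟨k₁, hk₁⟩ := exists_mem_piPrimePowBall z.1
    obtain ⟨k₂, hk₂⟩ := exists_mem_piPrimePowBall z.2
    refine Set.mem_iUnion.2 ⟨max k₁ k₂, ?_, ?_⟩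
    · exact piPrimePowBall_antitone (by simp) hk₁
    · exact piPrimePowBall_antitone (by simp) hk₂
  have hdir : Directed (· ⊆ ·) fun k : ℕ => piPrimePowBall K ι (-(k : ℤ)) ×ˢ piPrimePowBall K ι (-(k : ℤ)) :=
    Monotone.directed_le fun a b hab => hbox _ _ (by omega)
  obtain ⟨k₀, hk₀⟩ := hcs.elim_directed_cover _ (fun k => (isOpen_piPrimePowBall _).prod (isOpen_piPrimePowBall _))
    hcover hdir
  -- bound
  obtain ⟨A, hA⟩ := hlc.continuous.bounded_above_of_compact_support hcs
  refine ⟨N, -(k₀ : ℤ), A, fun z t ht => ?_, fun z hz => image_eq_zero_of_notMem_tsupport fun h => hz (hk₀ h), hA⟩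
  by_cases hz : z ∈ S
  · exact step1 z hz t ht
  · have hΦz : Φ z = 0 := image_eq_zero_of_notMem_tsupport hz
    by_cases hzt : z + t ∈ S
    · have h' := step1 (z + t) hzt (-t) (hneg _ _ ht)
      rw [add_neg_cancel_right] at h'
      rw [← h']
    · rw [image_eq_zero_of_notMem_tsupport hzt, hΦz]

omit [Fintype ι] [MeasurableSpace K] [BorelSpace K] in
/-- instance helper: `K` is second countable. [cite: WeilBNT1967, Ch. I §2, Th. 3 Cor. 3] -/
private theorem secondCountable' : SecondCountableTopology K := secondCountableTopology_localField K

omit [Fintype ι] [BorelSpace K] in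
/-- instance helper: a Haar measure on `K` is `σ`-finite. [cite: WeilBNT1967, Ch. I §2, Th. 3 Cor. 3] -/
private theorem sigmaFinite_haarA2 : SigmaFinite μ := by
  haveI : T2Space K :=
    (Literature.NumberTheory.GaloisRepresentations.IsNonarchimedeanLocalField.isLocalField K).toT2Space
  haveI : LocallyCompactSpace K :=
    (Literature.NumberTheory.GaloisRepresentations.IsNonarchimedeanLocalField.isLocalField K).toLocallyCompactSpace
  haveI : SecondCountableTopology K := secondCountable'
  infer_instance

/-- a Schwartz–Bruhat function on `K^ι × K^ι` is measurable (locally constant ⇒ continuous; the product `σ`-algebra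
is the Borel `σ`-algebra of the second countable `K^ι × K^ι`). [cite: WeilBNT1967, Ch. I §2, Th. 3 Cor. 3] -/
theorem measurable_of_mem_schwartzBruhat {Φ : (ι → K) × (ι → K) → ℂ}
    (hΦ : Φ ∈ SchwartzBruhat ((ι → K) × (ι → K))) : Measurable Φ := by
  haveI : SecondCountableTopology K := secondCountable'
  exact ((mem_schwartzBruhat_iff).1 hΦ).1.continuous.measurable

omit [Fintype ι] [MeasurableSpace K] [BorelSpace K] in
/-- the slices `Φ(x, ·)` of a function invariant under a product of boxes are invariant under the box. [cite: Weil1965, Chap. V n° 49 Lemma 22, p. 70] -/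
theorem slice_invariant {Φ : (ι → K) × (ι → K) → ℂ} {ℓ : ℤ}
    (hΦ : ∀ z, ∀ t ∈ piPrimePowBall K ι ℓ ×ˢ piPrimePowBall K ι ℓ, Φ (z + t) = Φ z) (x : ι → K) :
    ∀ y, ∀ t ∈ piPrimePowBall K ι ℓ, (fun y => Φ (x, y)) (y + t) = (fun y => Φ (x, y)) y := by
  intro y t ht
  have h := hΦ (x, y) (0, t) ⟨zero_mem_piPrimePowBall ℓ, ht⟩
  simpa using h

/-- a bounded measurable function supported in a box is integrable. [cite: WeilBNT1967, Ch. I §2, Th. 3 Cor. 3] -/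
theorem integrable_of_bounded_of_support {f : (ι → K) → ℂ} (hf : Measurable f) {A : ℝ} (hA : ∀ y, ‖f y‖ ≤ A)
    {n₀ : ℤ} (hs : ∀ y, y ∉ piPrimePowBall K ι n₀ → f y = 0) : Integrable f (Measure.pi fun _ : ι => μ) := by
  refine IntegrableOn.integrable_of_forall_notMem_eq_zero (s := piPrimePowBall K ι n₀) ?_ hs
  exact Measure.integrableOn_of_bounded (measure_pi_piPrimePowBall_lt_top μ n₀).ne hf.aestronglyMeasurable
    (Eventually.of_forall hA)

/-- the `L¹` norm of such a function is at most `A · μ^ι((𝔭^{n₀})^ι)`. [cite: WeilBNT1967, Ch. I §2, Th. 3 Cor. 3] -/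
theorem integral_norm_le_of_bounded_of_support {f : (ι → K) → ℂ} {A : ℝ} (hA : ∀ y, ‖f y‖ ≤ A)
    {n₀ : ℤ} (hs : ∀ y, y ∉ piPrimePowBall K ι n₀ → f y = 0) :
    ∫ y, ‖f y‖ ∂(Measure.pi fun _ : ι => μ) ≤ A * (Measure.pi fun _ : ι => μ).real (piPrimePowBall K ι n₀) := by
  have hA0 : 0 ≤ A := (norm_nonneg _).trans (hA 0)
  have h : ∀ y, ‖f y‖ ≤ (piPrimePowBall K ι n₀).indicator (fun _ => A) y := by
    intro y
    by_cases hy : y ∈ piPrimePowBall K ι n₀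
    · rw [Set.indicator_of_mem hy]; exact hA y
    · rw [Set.indicator_of_notMem hy, hs y hy, norm_zero]
  calc ∫ y, ‖f y‖ ∂(Measure.pi fun _ : ι => μ)
      ≤ ∫ y, (piPrimePowBall K ι n₀).indicator (fun _ => A) y ∂(Measure.pi fun _ : ι => μ) := by
        refine integral_mono_of_nonneg (Eventually.of_forall fun _ => norm_nonneg _) ?_ (Eventually.of_forall h)
        exact (integrable_indicator_iff (measurableSet_piPrimePowBall' n₀)).2
          ((integrableOn_const_iff (C := A)).2 (Or.inr (measure_pi_piPrimePowBall_lt_top μ n₀)))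
    _ = A * (Measure.pi fun _ : ι => μ).real (piPrimePowBall K ι n₀) := by
        rw [integral_indicator_const _ (measurableSet_piPrimePowBall' n₀), smul_eq_mul, mul_comm]

/-- **the fibre average is the `x`-integral of the slab averages** (Fubini). [cite: Weil1965, Chap. IV n° 44 Thm 2, p. 63] -/
theorem fibreAvg_eq_integral_sliceAvg {Φ : (ι → K) × (ι → K) → ℂ} (hΦm : Measurable Φ) {A : ℝ}
    (hA : ∀ z, ‖Φ z‖ ≤ A) {n₀ : ℤ} (hs : ∀ z, z ∉ piPrimePowBall K ι n₀ ×ˢ piPrimePowBall K ι n₀ → Φ z = 0)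
    (b : K) (r : ℤ) :
    fibreAvg μ Φ b r = ∫ x, (μ.real (primePowBall K r) : ℂ)⁻¹ * sliceIntegral μ x (fun y => Φ (x, y)) b r
      ∂(Measure.pi fun _ : ι => μ) := by
  haveI : SecondCountableTopology K := secondCountable'
  haveI := sigmaFinite_haarA2 μ
  set G : (ι → K) × (ι → K) → ℂ := fun z => (b +ᵥ primePowBall K r).indicator (1 : K → ℂ) (z.1 ⬝ᵥ z.2) * Φ z
    with hG
  have hGm : Measurable G := by
    have h1 : Measurable fun z : (ι → K) × (ι → K) => z.1 ⬝ᵥ z.2 :=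
      (continuous_finsetSum _ fun i _ => ((continuous_apply i).comp continuous_fst).mul
        ((continuous_apply i).comp continuous_snd)).measurable
    exact ((measurable_const.indicator (measurableSet_vadd_primePowBall r b)).comp h1).mul hΦm
  have hGi : Integrable G ((Measure.pi fun _ : ι => μ).prod (Measure.pi fun _ : ι => μ)) := by
    refine IntegrableOn.integrable_of_forall_notMem_eq_zero
      (s := piPrimePowBall K ι n₀ ×ˢ piPrimePowBall K ι n₀) ?_ fun z hz => by rw [hG]; simp [hs z hz]
    refine Measure.integrableOn_of_bounded (M := A) ?_ hGm.aestronglyMeasurable (Eventually.of_forall fun z => ?_)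
    · rw [Measure.prod_prod]
      exact (ENNReal.mul_lt_top (measure_pi_piPrimePowBall_lt_top μ n₀) (measure_pi_piPrimePowBall_lt_top μ n₀)).ne
    · rw [hG]
      exact (norm_slabIndicator_mul_le z.1 (fun y => Φ (z.1, y)) b r z.2).trans (hA z)
  rw [fibreAvg, integral_prod G hGi, ← integral_const_mul]
  rfl

/-- **CONVERGENCE OF THE FIBRE AVERAGES** [Weil1965, Chap. IV n° 44 Thm 2 at a split place]: for `|ι| ≥ 2` and `Φ`
Schwartz–Bruhat on `K^ι × K^ι`, `μ(𝔭^r)⁻¹ ∫_{x ⬝ᵥ y ∈ b + 𝔭^r} Φ → F_Φ(b)` as `r → ∞`, for EVERY `b ∈ K` — including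
the singular value `b = 0` (the cone), where the integrability of the level weight (`|ι| ≥ 2`) is used. Dominated
convergence in `x` of the slab averages, which converge pointwise (plateau) and are dominated by `M · μ(𝔭^{ℓ+level x})⁻¹`.
[cite: Weil1965, Chap. IV n° 44 Thm 2, p. 63] [cite: Weil1965, Chap. III n° 37 Prop. 6, p. 54] -/
theorem tendsto_fibreAvg [Nonempty ι] [DecidableEq ι] [MeasurableSingletonClass K] (hι : 2 ≤ Fintype.card ι)
    {Φ : (ι → K) × (ι → K) → ℂ} (hΦ : Φ ∈ SchwartzBruhat ((ι → K) × (ι → K))) (b : K) :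
    Tendsto (fun r : ℤ => fibreAvg μ Φ b r) atTop (𝓝 (fibreDensity μ Φ b)) := by
  haveI : SecondCountableTopology K := secondCountable'
  haveI := sigmaFinite_haarA2 μ
  obtain ⟨ℓ, n₀, A, hinv, hsupp, hA⟩ := exists_structure_of_mem_schwartzBruhat hΦ
  have hΦm : Measurable Φ := measurable_of_mem_schwartzBruhat hΦ
  -- the slices
  have hf_inv : ∀ x, ∀ y, ∀ t ∈ piPrimePowBall K ι ℓ, (fun y => Φ (x, y)) (y + t) = (fun y => Φ (x, y)) y :=
    fun x => slice_invariant hinv x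
  have hf_meas : ∀ x, Measurable fun y => Φ (x, y) := fun x => hΦm.comp measurable_prodMk_left
  have hf_supp : ∀ x y, y ∉ piPrimePowBall K ι n₀ → Φ (x, y) = 0 := fun x y hy => hsupp (x, y) fun h => hy h.2
  have hf_int : ∀ x, Integrable (fun y => Φ (x, y)) (Measure.pi fun _ : ι => μ) := fun x =>
    integrable_of_bounded_of_support μ (hf_meas x) (fun y => hA (x, y)) (hf_supp x)
  set M : ℝ := A * (Measure.pi fun _ : ι => μ).real (piPrimePowBall K ι n₀) with hM
  have hM0 : 0 ≤ M := mul_nonneg ((norm_nonneg _).trans (hA 0)) measureReal_nonneg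
  have hf_L1 : ∀ x, ∫ y, ‖Φ (x, y)‖ ∂(Measure.pi fun _ : ι => μ) ≤ M := fun x =>
    integral_norm_le_of_bounded_of_support μ (fun y => hA (x, y)) (hf_supp x)
  -- off the `x`-support the slice is zero
  have hf_zero : ∀ x, x ∉ piPrimePowBall K ι n₀ → (fun y => Φ (x, y)) = fun _ => 0 := fun x hx =>
    funext fun y => hsupp (x, y) fun h => hx h.1
  -- the dominated-convergence data
  set F : ℤ → (ι → K) → ℂ := fun r x => (μ.real (primePowBall K r) : ℂ)⁻¹ * sliceIntegral μ x (fun y => Φ (x, y)) b r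
    with hF
  set bound : (ι → K) → ℝ := fun x => M * (piPrimePowBall K ι n₀).indicator (levelWeight μ ℓ) x with hbound
  have hF_meas : ∀ r, AEStronglyMeasurable (F r) (Measure.pi fun _ : ι => μ) := by
    intro r
    have h1 : Measurable fun z : (ι → K) × (ι → K) => z.1 ⬝ᵥ z.2 :=
      (continuous_finsetSum _ fun i _ => ((continuous_apply i).comp continuous_fst).mul
        ((continuous_apply i).comp continuous_snd)).measurable
    have hGm : Measurable fun z : (ι → K) × (ι → K) =>
        (b +ᵥ primePowBall K r).indicator (1 : K → ℂ) (z.1 ⬝ᵥ z.2) * Φ z :=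
      ((measurable_const.indicator (measurableSet_vadd_primePowBall r b)).comp h1).mul hΦm
    exact (hGm.stronglyMeasurable.integral_prod_right'.aestronglyMeasurable).const_mul _
  have hae : ∀ᵐ x ∂(Measure.pi fun _ : ι => μ), x ≠ (0 : ι → K) := by
    have h := measure_eq_zero_iff_ae_notMem.1 (measure_pi_singleton_zero (ι := ι) μ)
    filter_upwards [h] with x hx using fun h0 => hx (h0 ▸ Set.mem_singleton _)
  have h_bound : ∀ r, ∀ᵐ x ∂(Measure.pi fun _ : ι => μ), ‖F r x‖ ≤ bound x := by
    intro r
    filter_upwards [hae] with x hx0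
    by_cases hx : x ∈ piPrimePowBall K ι n₀
    · rw [hbound]
      simp only [Set.indicator_of_mem hx]
      calc ‖F r x‖ ≤ (μ.real (primePowBall K (ℓ + level x)))⁻¹ * ∫ y, ‖Φ (x, y)‖ ∂(Measure.pi fun _ : ι => μ) :=
            norm_sliceAvg_le μ (mem_shell_level hx0) (hf_inv x) (hf_int x) b r
        _ ≤ (μ.real (primePowBall K (ℓ + level x)))⁻¹ * M :=
            mul_le_mul_of_nonneg_left (hf_L1 x) (inv_nonneg.2 measureReal_nonneg)
        _ = M * levelWeight μ ℓ x := by rw [levelWeight, mul_comm]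
    · have h0 : F r x = 0 := by
        simp only [hF, hf_zero x hx, sliceIntegral_zero_fun, mul_zero]
      rw [h0, norm_zero, hbound]
      simp only [Set.indicator_of_notMem hx, mul_zero, le_refl]
  have h_int : Integrable bound (Measure.pi fun _ : ι => μ) :=
    ((integrableOn_levelWeight μ hι ℓ n₀).integrable_indicator (measurableSet_piPrimePowBall' n₀)).const_mul M
  have h_lim : ∀ᵐ x ∂(Measure.pi fun _ : ι => μ),
      Tendsto (fun r => F r x) atTop (𝓝 (sliceDensity μ x (fun y => Φ (x, y)) b)) := by
    filter_upwards [hae] with x hx0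
    exact tendsto_sliceAvg μ (mem_shell_level hx0) (hf_inv x) (hf_int x) b
  have hmain := tendsto_integral_filter_of_dominated_convergence bound (Eventually.of_forall hF_meas)
    (Eventually.of_forall h_bound) h_int h_lim
  refine (tendsto_congr fun r => ?_).2 hmain
  exact fibreAvg_eq_integral_sliceAvg μ hΦm hA hsupp b r

/-! ### Continuity of the fibre density (in particular at the cone `b = 0`) -/

omit [Fintype ι] [MeasurableSpace K] [BorelSpace K] in
/-- the boxes shrink to the origin: `⋂_m (𝔭^m)^ι = {0}`. [cite: WeilBNT1967, Ch. II §2, Def. 2] -/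
theorem iInter_piPrimePowBall_eq (c : ℤ) : ⋂ m : ℤ, piPrimePowBall K ι (m + c) = {0} := by
  ext x
  simp only [Set.mem_iInter, Set.mem_singleton_iff]
  constructor
  · intro h
    funext i
    by_contra hxi
    obtain ⟨k, hk⟩ := exists_normAbs_eq_inv_zpow hxi
    have h1 : normAbs K (x i) ≤ ((residueFieldCard K : ℝ≥0)⁻¹) ^ (k + 1) := by
      have := mem_piPrimePowBall_iff.1 (h (k + 1 - c)) i
      rwa [mem_primePowBall_iff, show k + 1 - c + c = k + 1 by ring] at this
    rw [hk] at h1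
    exact absurd h1 (not_le.2 (inv_zpow_succ_lt k))
  · rintro rfl m
    exact zero_mem_piPrimePowBall _

/-- the slice densities of `Φ` are dominated by `M · w_ℓ` on the support box and vanish off it. [cite: Weil1965, Chap. V n° 49 Lemma 22, p. 70] -/
theorem norm_sliceDensity_le_levelWeight [Nonempty ι] [DecidableEq ι] {Φ : (ι → K) × (ι → K) → ℂ} {ℓ n₀ : ℤ} {A : ℝ}
    (hinv : ∀ z, ∀ t ∈ piPrimePowBall K ι ℓ ×ˢ piPrimePowBall K ι ℓ, Φ (z + t) = Φ z)
    (hsupp : ∀ z, z ∉ piPrimePowBall K ι n₀ ×ˢ piPrimePowBall K ι n₀ → Φ z = 0) (hA : ∀ z, ‖Φ z‖ ≤ A)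
    (hΦm : Measurable Φ) {x : ι → K} (hx0 : x ≠ 0) (b : K) :
    ‖sliceDensity μ x (fun y => Φ (x, y)) b‖ ≤
      (A * (Measure.pi fun _ : ι => μ).real (piPrimePowBall K ι n₀)) *
        (piPrimePowBall K ι n₀).indicator (levelWeight μ ℓ) x := by
  by_cases hx : x ∈ piPrimePowBall K ι n₀
  · rw [Set.indicator_of_mem hx]
    have hf_supp : ∀ y, y ∉ piPrimePowBall K ι n₀ → Φ (x, y) = 0 := fun y hy => hsupp (x, y) fun h => hy h.2
    calc ‖sliceDensity μ x (fun y => Φ (x, y)) b‖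
        ≤ (μ.real (primePowBall K (ℓ + level x)))⁻¹ * ∫ y, ‖Φ (x, y)‖ ∂(Measure.pi fun _ : ι => μ) :=
          norm_sliceDensity_le μ (mem_shell_level hx0) (slice_invariant hinv x)
            (integrable_of_bounded_of_support μ (hΦm.comp measurable_prodMk_left) (fun y => hA (x, y)) hf_supp) b
      _ ≤ (μ.real (primePowBall K (ℓ + level x)))⁻¹ * (A * (Measure.pi fun _ : ι => μ).real (piPrimePowBall K ι n₀)) :=
          mul_le_mul_of_nonneg_left (integral_norm_le_of_bounded_of_support μ (fun y => hA (x, y)) hf_supp)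
            (inv_nonneg.2 measureReal_nonneg)
      _ = _ := by rw [levelWeight, mul_comm]
  · have h0 : (fun y => Φ (x, y)) = fun _ => 0 := funext fun y => hsupp (x, y) fun h => hx h.1
    rw [h0, sliceDensity_zero_fun, norm_zero, Set.indicator_of_notMem hx, mul_zero]

/-- the slice densities `x ↦ s(x, Φ(x,·); b)` are integrable on `K^ι` (dominated by `M · w_ℓ` on the support box;
measurable as an a.e. limit of the slab averages). [cite: Weil1965, Chap. IV n° 44 Thm 2, p. 63] -/
theorem integrable_sliceDensity [Nonempty ι] [DecidableEq ι] [MeasurableSingletonClass K] (hι : 2 ≤ Fintype.card ι)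
    {Φ : (ι → K) × (ι → K) → ℂ} {ℓ n₀ : ℤ} {A : ℝ}
    (hinv : ∀ z, ∀ t ∈ piPrimePowBall K ι ℓ ×ˢ piPrimePowBall K ι ℓ, Φ (z + t) = Φ z)
    (hsupp : ∀ z, z ∉ piPrimePowBall K ι n₀ ×ˢ piPrimePowBall K ι n₀ → Φ z = 0) (hA : ∀ z, ‖Φ z‖ ≤ A)
    (hΦm : Measurable Φ) (b : K) :
    Integrable (fun x => sliceDensity μ x (fun y => Φ (x, y)) b) (Measure.pi fun _ : ι => μ) := by
  haveI : SecondCountableTopology K := secondCountable'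
  haveI := sigmaFinite_haarA2 μ
  have hae : ∀ᵐ x ∂(Measure.pi fun _ : ι => μ), x ≠ (0 : ι → K) := by
    have h := measure_eq_zero_iff_ae_notMem.1 (measure_pi_singleton_zero (ι := ι) μ)
    filter_upwards [h] with x hx using fun h0 => hx (h0 ▸ Set.mem_singleton _)
  refine Integrable.mono' ((((integrableOn_levelWeight μ hι ℓ n₀).integrable_indicator
    (measurableSet_piPrimePowBall' n₀)).const_mul (A * (Measure.pi fun _ : ι => μ).real (piPrimePowBall K ι n₀))))
    ?_ ?_
  · have h1 : Measurable fun z : (ι → K) × (ι → K) => z.1 ⬝ᵥ z.2 :=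
      (continuous_finsetSum _ fun i _ => ((continuous_apply i).comp continuous_fst).mul
        ((continuous_apply i).comp continuous_snd)).measurable
    have hFm : ∀ r : ℤ, AEStronglyMeasurable (fun x => (μ.real (primePowBall K r) : ℂ)⁻¹ *
        sliceIntegral μ x (fun y => Φ (x, y)) b r) (Measure.pi fun _ : ι => μ) := fun r =>
      ((((measurable_const.indicator (measurableSet_vadd_primePowBall r b)).comp h1).mul
        hΦm).stronglyMeasurable.integral_prod_right'.aestronglyMeasurable).const_mul _
    refine aestronglyMeasurable_of_tendsto_ae atTop hFm ?_
    filter_upwards [hae] with x hx0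
    exact tendsto_sliceAvg μ (mem_shell_level hx0) (slice_invariant hinv x)
      (integrable_of_bounded_of_support μ (hΦm.comp measurable_prodMk_left) (fun y => hA (x, y))
        (fun y hy => hsupp (x, y) fun h => hy h.2)) b
  · filter_upwards [hae] with x hx0
    exact norm_sliceDensity_le_levelWeight μ hinv hsupp hA hΦm hx0 b

/-- **CONTINUITY OF THE FIBRE DENSITY on all of `K`** — in particular AT `b = 0` [Weil1965, Chap. III n° 37 Prop. 6]: for
`b ∈ b₀ + 𝔭^m` the slice densities at `b` and `b₀` agree for every `x` of level `≤ m - ℓ` (local constancy), so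
`|F_Φ(b) - F_Φ(b₀)| ≤ 2M ∫_{(𝔭^{m-ℓ+1})^ι} w_ℓ → 0` (the boxes shrink to the null point `0`, `w_ℓ` integrable: `|ι| ≥ 2`).
[cite: Weil1965, Chap. III n° 37 Prop. 6, p. 54] [cite: Weil1965, Chap. V n° 50 (40), p. 74] -/
theorem continuous_fibreDensity [Nonempty ι] [DecidableEq ι] [MeasurableSingletonClass K] (hι : 2 ≤ Fintype.card ι)
    {Φ : (ι → K) × (ι → K) → ℂ} (hΦ : Φ ∈ SchwartzBruhat ((ι → K) × (ι → K))) :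
    Continuous (fibreDensity μ Φ) := by
  haveI : SecondCountableTopology K := secondCountable'
  haveI := sigmaFinite_haarA2 μ
  obtain ⟨ℓ, n₀, A, hinv, hsupp, hA⟩ := exists_structure_of_mem_schwartzBruhat hΦ
  have hΦm : Measurable Φ := measurable_of_mem_schwartzBruhat hΦ
  set M : ℝ := A * (Measure.pi fun _ : ι => μ).real (piPrimePowBall K ι n₀) with hM
  have hM0 : 0 ≤ M := mul_nonneg ((norm_nonneg _).trans (hA 0)) measureReal_nonneg
  set sD : (ι → K) → K → ℂ := fun x b => sliceDensity μ x (fun y => Φ (x, y)) b with hsD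
  have hae : ∀ᵐ x ∂(Measure.pi fun _ : ι => μ), x ≠ (0 : ι → K) := by
    have h := measure_eq_zero_iff_ae_notMem.1 (measure_pi_singleton_zero (ι := ι) μ)
    filter_upwards [h] with x hx using fun h0 => hx (h0 ▸ Set.mem_singleton _)
  -- the tail integrals
  set tail : ℤ → ℝ := fun m => ∫ x in piPrimePowBall K ι (m + (1 - ℓ)), levelWeight μ ℓ x ∂(Measure.pi fun _ : ι => μ)
    with htail
  have htail0 : Tendsto tail atTop (𝓝 0) := by
    have h := tendsto_setIntegral_of_antitone (μ := Measure.pi fun _ : ι => μ) (f := levelWeight μ ℓ)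
      (s := fun m : ℤ => piPrimePowBall K ι (m + (1 - ℓ))) (fun m => measurableSet_piPrimePowBall' _)
      (fun m m' h => piPrimePowBall_antitone (by omega)) ⟨0, integrableOn_levelWeight μ hι ℓ _⟩
    rwa [iInter_piPrimePowBall_eq, setIntegral_measure_zero _ (measure_pi_singleton_zero μ)] at h
  -- the key estimate: `‖F b - F b₀‖ ≤ 2 M · tail m` for `b ∈ b₀ + 𝔭^m`
  have hkey : ∀ (b₀ : K) (m : ℤ), ∀ b ∈ b₀ +ᵥ primePowBall K m,
      ‖fibreDensity μ Φ b - fibreDensity μ Φ b₀‖ ≤ 2 * M * tail m := by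
    intro b₀ m b hb
    have hint : ∀ b', Integrable (fun x => sD x b') (Measure.pi fun _ : ι => μ) := fun b' =>
      integrable_sliceDensity μ hι hinv hsupp hA hΦm b'
    have hdiff : fibreDensity μ Φ b - fibreDensity μ Φ b₀ = ∫ x, (sD x b - sD x b₀) ∂(Measure.pi fun _ : ι => μ) := by
      rw [fibreDensity, fibreDensity, ← integral_sub (hint b) (hint b₀)]
    -- pointwise bound of the difference
    have hpt : ∀ᵐ x ∂(Measure.pi fun _ : ι => μ), ‖sD x b - sD x b₀‖ ≤
        2 * M * (piPrimePowBall K ι (m + (1 - ℓ))).indicator (levelWeight μ ℓ) x := by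
      filter_upwards [hae] with x hx0
      by_cases hsmall : x ∈ piPrimePowBall K ι (m + (1 - ℓ))
      · rw [Set.indicator_of_mem hsmall]
        have h1 := norm_sliceDensity_le_levelWeight μ hinv hsupp hA hΦm hx0 b
        have h2 := norm_sliceDensity_le_levelWeight μ hinv hsupp hA hΦm hx0 b₀
        have hw : (piPrimePowBall K ι n₀).indicator (levelWeight μ ℓ) x ≤ levelWeight μ ℓ x := by
          by_cases h : x ∈ piPrimePowBall K ι n₀
          · rw [Set.indicator_of_mem h]
          · rw [Set.indicator_of_notMem h]; exact (levelWeight_pos μ ℓ x).le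
        calc ‖sD x b - sD x b₀‖ ≤ ‖sD x b‖ + ‖sD x b₀‖ := norm_sub_le _ _
          _ ≤ M * levelWeight μ ℓ x + M * levelWeight μ ℓ x :=
              add_le_add (h1.trans (mul_le_mul_of_nonneg_left hw hM0)) (h2.trans (mul_le_mul_of_nonneg_left hw hM0))
          _ = 2 * M * levelWeight μ ℓ x := by ring
      · -- large `x`: level `x ≤ m - ℓ`, so `b ∈ b₀ + 𝔭^{ℓ + level x}` and the slice densities agree
        have hlev : ℓ + level x ≤ m := by
          by_contra h
          apply hsmall
          exact piPrimePowBall_antitone (by omega) (mem_shell_level hx0).1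
        have hb' : b ∈ b₀ +ᵥ primePowBall K (ℓ + level x) := by
          rw [mem_vadd_primePowBall_iff] at hb ⊢
          exact primePowBall_antitone hlev hb
        have heq : sD x b = sD x b₀ :=
          sliceDensity_eq_of_mem_vadd μ (mem_shell_level hx0) (slice_invariant hinv x)
            (integrable_of_bounded_of_support μ (hΦm.comp measurable_prodMk_left) (fun y => hA (x, y))
              (fun y hy => hsupp (x, y) fun h => hy h.2)) hb'
        rw [heq, sub_self, norm_zero, Set.indicator_of_notMem hsmall, mul_zero]
    rw [hdiff]
    calc ‖∫ x, (sD x b - sD x b₀) ∂(Measure.pi fun _ : ι => μ)‖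
        ≤ ∫ x, 2 * M * (piPrimePowBall K ι (m + (1 - ℓ))).indicator (levelWeight μ ℓ) x ∂(Measure.pi fun _ : ι => μ) :=
          norm_integral_le_of_norm_le ((((integrableOn_levelWeight μ hι ℓ _).integrable_indicator
            (measurableSet_piPrimePowBall' _)).const_mul (2 * M))) hpt
      _ = 2 * M * tail m := by
          rw [integral_const_mul, htail]
          simp only
          rw [integral_indicator (measurableSet_piPrimePowBall' _)]
  -- conclude
  refine continuous_iff_continuousAt.2 fun b₀ => ?_
  rw [ContinuousAt, Metric.tendsto_nhds]
  intro ε hε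
  have hev : ∀ᶠ m : ℤ in atTop, 2 * M * tail m < ε := by
    have h2 : Tendsto (fun m => 2 * M * tail m) atTop (𝓝 0) := by
      simpa using htail0.const_mul (2 * M)
    exact (h2.eventually (gt_mem_nhds hε))
  obtain ⟨m, hm⟩ := hev.exists
  filter_upwards [(isOpen_vadd_primePowBall m b₀).mem_nhds (self_mem_vadd_primePowBall m b₀)] with b hb
  rw [dist_eq_norm]
  exact (hkey b₀ m b hb).trans_lt hm

/-! ### Disintegration: `fibreDensity` is the density of `h_*(Φ · dμ^ι ⊗ dμ^ι)` -/

/-- **slice disintegration**: for `x ≠ 0`, `∫_K g(b) s(x, Φ(x,·); b) dμ(b) = ∫_{K^ι} Φ(x, y) g(x ⬝ᵥ y) dμ^ι(y)` for `g`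
Schwartz–Bruhat on `K` (at a fine enough radius `r` the slab average IS the slice density, and `g` is constant on the
cosets `c + 𝔭^r`). [cite: Weil1965, Chap. IV n° 44 Thm 2, p. 63] -/
theorem integral_mul_sliceDensity [Nonempty ι] [DecidableEq ι] {Φ : (ι → K) × (ι → K) → ℂ} {ℓ n₀ : ℤ} {A : ℝ}
    (hinv : ∀ z, ∀ t ∈ piPrimePowBall K ι ℓ ×ˢ piPrimePowBall K ι ℓ, Φ (z + t) = Φ z)
    (hsupp : ∀ z, z ∉ piPrimePowBall K ι n₀ ×ˢ piPrimePowBall K ι n₀ → Φ z = 0) (hA : ∀ z, ‖Φ z‖ ≤ A)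
    (hΦm : Measurable Φ) {g : K → ℂ} (hg : g ∈ SchwartzBruhat K) {x : ι → K} (hx0 : x ≠ 0) :
    ∫ b, g b * sliceDensity μ x (fun y => Φ (x, y)) b ∂μ =
      ∫ y, Φ (x, y) * g (x ⬝ᵥ y) ∂(Measure.pi fun _ : ι => μ) := by
  haveI : SecondCountableTopology K := secondCountable'
  haveI := sigmaFinite_haarA2 μ
  obtain ⟨mg, hmg⟩ := exists_forall_add_eq_of_mem_schwartzBruhat hg
  obtain ⟨B, -, hB⟩ := exists_norm_le_of_mem_schwartzBruhat hg
  have hgc : Continuous g := continuous_of_mem_schwartzBruhat hg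
  have hgi : Integrable g μ := by
    obtain ⟨ng, hng⟩ := exists_eq_zero_of_notMem_primePowBall hg
    exact IntegrableOn.integrable_of_forall_notMem_eq_zero (s := primePowBall K ng)
      (Measure.integrableOn_of_bounded (measure_primePowBall_lt_top μ ng).ne hgc.aestronglyMeasurable
        (Eventually.of_forall hB)) hng
  have hf_inv := slice_invariant hinv x
  have hf_supp : ∀ y, y ∉ piPrimePowBall K ι n₀ → Φ (x, y) = 0 := fun y hy => hsupp (x, y) fun h => hy h.2
  have hf_int : Integrable (fun y => Φ (x, y)) (Measure.pi fun _ : ι => μ) :=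
    integrable_of_bounded_of_support μ (hΦm.comp measurable_prodMk_left) (fun y => hA (x, y)) hf_supp
  have hx := mem_shell_level hx0
  -- a common fine radius
  set r : ℤ := max (ℓ + level x) mg with hr
  have hsD : ∀ b, sliceDensity μ x (fun y => Φ (x, y)) b =
      (μ.real (primePowBall K r) : ℂ)⁻¹ * sliceIntegral μ x (fun y => Φ (x, y)) b r := fun b => by
    rw [sliceDensity_eq μ hx hf_inv hf_int, sliceIntegral_plateau μ hx hf_inv hf_int (le_max_left _ _) b]
  simp_rw [hsD, sliceIntegral]
  -- swap the `b`- and `y`-integrals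
  set H : K × (ι → K) → ℂ := fun p =>
    g p.1 * ((μ.real (primePowBall K r) : ℂ)⁻¹ * ((p.1 +ᵥ primePowBall K r).indicator (1 : K → ℂ) (x ⬝ᵥ p.2) * Φ (x, p.2)))
    with hH
  have hmeas2 : Measurable fun p : K × (ι → K) => (p.1 +ᵥ primePowBall K r).indicator (1 : K → ℂ) (x ⬝ᵥ p.2) := by
    have h : (fun p : K × (ι → K) => (p.1 +ᵥ primePowBall K r).indicator (1 : K → ℂ) (x ⬝ᵥ p.2)) =
        ((fun p : K × (ι → K) => x ⬝ᵥ p.2 - p.1) ⁻¹' primePowBall K r).indicator (fun _ => (1 : ℂ)) := by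
      funext p
      by_cases hp : x ⬝ᵥ p.2 ∈ p.1 +ᵥ primePowBall K r
      · rw [Set.indicator_of_mem hp, Set.indicator_of_mem (show p ∈ _ from mem_vadd_primePowBall_iff.1 hp)]; rfl
      · rw [Set.indicator_of_notMem hp,
          Set.indicator_of_notMem (show p ∉ _ from fun h => hp (mem_vadd_primePowBall_iff.2 h))]
    rw [h]
    exact measurable_const.indicator ((measurableSet_primePowBall r).preimage
      (((continuous_dotProduct_right x).comp continuous_snd).sub continuous_fst).measurable)
  have hHi : Integrable H (μ.prod (Measure.pi fun _ : ι => μ)) := by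
    have hprod : Integrable (fun p : K × (ι → K) => g p.1 * Φ (x, p.2)) (μ.prod (Measure.pi fun _ : ι => μ)) :=
      hgi.mul_prod hf_int
    refine (hprod.norm.const_mul ‖(μ.real (primePowBall K r) : ℂ)⁻¹‖).mono' ?_ (Eventually.of_forall fun p => ?_)
    · exact (hgc.measurable.comp measurable_fst).aestronglyMeasurable.mul
        ((hmeas2.aestronglyMeasurable.mul ((hΦm.comp measurable_prodMk_left).comp measurable_snd
          |>.aestronglyMeasurable)).const_mul _)
    · simp only [hH, norm_mul, norm_inv]
      have hind : ‖(p.1 +ᵥ primePowBall K r).indicator (1 : K → ℂ) (x ⬝ᵥ p.2)‖ ≤ 1 := by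
        by_cases hp : x ⬝ᵥ p.2 ∈ p.1 +ᵥ primePowBall K r
        · rw [Set.indicator_of_mem hp, Pi.one_apply, norm_one]
        · rw [Set.indicator_of_notMem hp, norm_zero]; exact zero_le_one
      have h1 : 0 ≤ ‖g p.1‖ := norm_nonneg _
      have h2 : 0 ≤ ‖Φ (x, p.2)‖ := norm_nonneg _
      have h3 : 0 ≤ ‖(μ.real (primePowBall K r) : ℂ)‖⁻¹ := inv_nonneg.2 (norm_nonneg _)
      nlinarith [mul_nonneg h1 h2, mul_nonneg (mul_nonneg h1 h2) h3]
  have hL : ∫ b, g b * ((μ.real (primePowBall K r) : ℂ)⁻¹ *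
      ∫ y, (b +ᵥ primePowBall K r).indicator (1 : K → ℂ) (x ⬝ᵥ y) * Φ (x, y) ∂(Measure.pi fun _ : ι => μ)) ∂μ =
      ∫ b, ∫ y, H (b, y) ∂(Measure.pi fun _ : ι => μ) ∂μ := by
    refine integral_congr_ae (Eventually.of_forall fun b => ?_)
    simp only [hH]
    rw [← integral_const_mul, ← integral_const_mul]
  rw [hL, integral_integral_swap hHi]
  refine integral_congr_ae (Eventually.of_forall fun y => ?_)
  simp only [hH]
  -- the base integral: `g` is constant on the coset `x ⬝ᵥ y + 𝔭^r`
  have hcoset : ∀ b, g b * ((μ.real (primePowBall K r) : ℂ)⁻¹ *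
      ((b +ᵥ primePowBall K r).indicator (1 : K → ℂ) (x ⬝ᵥ y) * Φ (x, y))) =
      (x ⬝ᵥ y +ᵥ primePowBall K r).indicator
        (fun _ => (μ.real (primePowBall K r) : ℂ)⁻¹ * (Φ (x, y) * g (x ⬝ᵥ y))) b := by
    intro b
    by_cases hb : b ∈ x ⬝ᵥ y +ᵥ primePowBall K r
    · have hb' : x ⬝ᵥ y ∈ b +ᵥ primePowBall K r := mem_vadd_primePowBall_comm.2 hb
      have hgb : g b = g (x ⬝ᵥ y) := by
        have e : b = x ⬝ᵥ y + (b - x ⬝ᵥ y) := by ring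
        rw [e, hmg _ _ (primePowBall_antitone (le_max_right _ _) (mem_vadd_primePowBall_iff.1 hb))]
      rw [Set.indicator_of_mem hb, Set.indicator_of_mem hb', hgb, Pi.one_apply, one_mul]
      ring
    · have hb' : x ⬝ᵥ y ∉ b +ᵥ primePowBall K r := fun h => hb (mem_vadd_primePowBall_comm.1 h)
      rw [Set.indicator_of_notMem hb, Set.indicator_of_notMem hb', zero_mul, mul_zero, mul_zero]
  simp_rw [hcoset]
  rw [integral_indicator_const _ (measurableSet_vadd_primePowBall r _), measureReal_def, measure_vadd,
    ← measureReal_def, Complex.real_smul, ← mul_assoc,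
    mul_inv_cancel₀ (Complex.ofReal_ne_zero.2 (measureReal_primePowBall_pos μ r).ne'), one_mul]

/-- **DISINTEGRATION** [Weil1965, Chap. IV n° 44 Thm 2 at a split place]: for `|ι| ≥ 2`, `Φ` Schwartz–Bruhat on
`K^ι × K^ι` and `g` Schwartz–Bruhat on `K`,
`∫_{K^ι × K^ι} Φ(x, y) g(x ⬝ᵥ y) d(μ^ι ⊗ μ^ι) = ∫_K g(b) F_Φ(b) dμ(b)` — so `b ↦ fibreDensity μ Φ b` IS the (continuous)
density, with respect to `μ`, of the image of the measure `Φ d(μ^ι ⊗ μ^ι)` under the split form `h(x, y) = x ⬝ᵥ y`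
(Weil's `F_Φ`, whose Fourier transform is `F*_Φ(b*) = ∫ Φ ψ(b* h)`). [cite: Weil1965, Chap. IV n° 44 Thm 2, p. 63] -/
theorem integral_mul_comp_dotProduct [Nonempty ι] [DecidableEq ι] [MeasurableSingletonClass K]
    (hι : 2 ≤ Fintype.card ι) {Φ : (ι → K) × (ι → K) → ℂ} (hΦ : Φ ∈ SchwartzBruhat ((ι → K) × (ι → K)))
    {g : K → ℂ} (hg : g ∈ SchwartzBruhat K) :
    ∫ z, Φ z * g (z.1 ⬝ᵥ z.2) ∂((Measure.pi fun _ : ι => μ).prod (Measure.pi fun _ : ι => μ)) =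
      ∫ b, g b * fibreDensity μ Φ b ∂μ := by
  haveI : SecondCountableTopology K := secondCountable'
  haveI := sigmaFinite_haarA2 μ
  obtain ⟨ℓ, n₀, A, hinv, hsupp, hA⟩ := exists_structure_of_mem_schwartzBruhat hΦ
  have hΦm : Measurable Φ := measurable_of_mem_schwartzBruhat hΦ
  obtain ⟨B, -, hB⟩ := exists_norm_le_of_mem_schwartzBruhat hg
  have hgc : Continuous g := continuous_of_mem_schwartzBruhat hg
  have hgi : Integrable g μ := by
    obtain ⟨ng, hng⟩ := exists_eq_zero_of_notMem_primePowBall hg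
    exact IntegrableOn.integrable_of_forall_notMem_eq_zero (s := primePowBall K ng)
      (Measure.integrableOn_of_bounded (measure_primePowBall_lt_top μ ng).ne hgc.aestronglyMeasurable
        (Eventually.of_forall hB)) hng
  set M : ℝ := A * (Measure.pi fun _ : ι => μ).real (piPrimePowBall K ι n₀) with hM
  set sD : (ι → K) → K → ℂ := fun x b => sliceDensity μ x (fun y => Φ (x, y)) b with hsD
  have h1 : Measurable fun z : (ι → K) × (ι → K) => z.1 ⬝ᵥ z.2 :=
    (continuous_finsetSum _ fun i _ => ((continuous_apply i).comp continuous_fst).mul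
      ((continuous_apply i).comp continuous_snd)).measurable
  -- (1) the left-hand side as an iterated integral
  have hPi : Integrable (fun z : (ι → K) × (ι → K) => Φ z * g (z.1 ⬝ᵥ z.2))
      ((Measure.pi fun _ : ι => μ).prod (Measure.pi fun _ : ι => μ)) := by
    refine IntegrableOn.integrable_of_forall_notMem_eq_zero
      (s := piPrimePowBall K ι n₀ ×ˢ piPrimePowBall K ι n₀) ?_ fun z hz => by simp [hsupp z hz]
    refine Measure.integrableOn_of_bounded (M := A * B) ?_ ((hΦm.mul (hgc.measurable.comp h1)).aestronglyMeasurable)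
      (Eventually.of_forall fun z => ?_)
    · rw [Measure.prod_prod]
      exact (ENNReal.mul_lt_top (measure_pi_piPrimePowBall_lt_top μ n₀) (measure_pi_piPrimePowBall_lt_top μ n₀)).ne
    · rw [norm_mul]
      exact mul_le_mul (hA z) (hB _) (norm_nonneg _) ((norm_nonneg _).trans (hA z))
  rw [integral_prod _ hPi]
  -- (2) joint measurability of the slice densities `(b, x) ↦ sD x b` (a.e. limit of the slab averages)
  have hae2 : ∀ᵐ p ∂(μ.prod (Measure.pi fun _ : ι => μ)), (p : K × (ι → K)).2 ≠ 0 := by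
    have h0 : (μ.prod (Measure.pi fun _ : ι => μ)) (Set.univ ×ˢ ({0} : Set (ι → K))) = 0 := by
      rw [Measure.prod_prod, measure_pi_singleton_zero μ, mul_zero]
    filter_upwards [measure_eq_zero_iff_ae_notMem.1 h0] with p hp
    exact fun h => hp ⟨Set.mem_univ _, h⟩
  have hsDm : AEStronglyMeasurable (fun p : K × (ι → K) => sD p.2 p.1) (μ.prod (Measure.pi fun _ : ι => μ)) := by
    have hJm : ∀ r : ℤ, AEStronglyMeasurable (fun p : K × (ι → K) => (μ.real (primePowBall K r) : ℂ)⁻¹ *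
        sliceIntegral μ p.2 (fun y => Φ (p.2, y)) p.1 r) (μ.prod (Measure.pi fun _ : ι => μ)) := by
      intro r
      have hT : Measurable fun q : (K × (ι → K)) × (ι → K) =>
          (q.1.1 +ᵥ primePowBall K r).indicator (1 : K → ℂ) (q.1.2 ⬝ᵥ q.2) * Φ (q.1.2, q.2) := by
        have hdot : Measurable fun q : (K × (ι → K)) × (ι → K) => q.1.2 ⬝ᵥ q.2 :=
          (continuous_finsetSum _ fun i _ => (((continuous_apply i).comp (continuous_snd.comp continuous_fst))).mul
            ((continuous_apply i).comp continuous_snd)).measurable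
        have hind : (fun q : (K × (ι → K)) × (ι → K) => (q.1.1 +ᵥ primePowBall K r).indicator (1 : K → ℂ) (q.1.2 ⬝ᵥ q.2)) =
            ((fun q : (K × (ι → K)) × (ι → K) => q.1.2 ⬝ᵥ q.2 - q.1.1) ⁻¹' primePowBall K r).indicator
              (fun _ => (1 : ℂ)) := by
          funext q
          by_cases hq : q.1.2 ⬝ᵥ q.2 ∈ q.1.1 +ᵥ primePowBall K r
          · rw [Set.indicator_of_mem hq, Set.indicator_of_mem (show q ∈ _ from mem_vadd_primePowBall_iff.1 hq)]; rfl
          · rw [Set.indicator_of_notMem hq,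
              Set.indicator_of_notMem (show q ∉ _ from fun h => hq (mem_vadd_primePowBall_iff.2 h))]
        have hindm : Measurable fun q : (K × (ι → K)) × (ι → K) =>
            (q.1.1 +ᵥ primePowBall K r).indicator (1 : K → ℂ) (q.1.2 ⬝ᵥ q.2) := by
          rw [hind]
          exact measurable_const.indicator ((measurableSet_primePowBall r).preimage
            (hdot.sub (measurable_fst.comp measurable_fst)))
        exact hindm.mul (hΦm.comp ((measurable_snd.comp measurable_fst).prodMk measurable_snd))
      exact (hT.stronglyMeasurable.integral_prod_right'.aestronglyMeasurable).const_mul _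
    refine aestronglyMeasurable_of_tendsto_ae atTop hJm ?_
    filter_upwards [hae2] with p hp0
    exact tendsto_sliceAvg μ (mem_shell_level hp0) (slice_invariant hinv p.2)
      (integrable_of_bounded_of_support μ (hΦm.comp measurable_prodMk_left) (fun y => hA (p.2, y))
        (fun y hy => hsupp (p.2, y) fun h => hy h.2)) p.1
  -- (3) integrability of `(b, x) ↦ g b · sD x b` and the swap
  have hWi : Integrable (fun p : K × (ι → K) => g p.1 * sD p.2 p.1) (μ.prod (Measure.pi fun _ : ι => μ)) := by
    have hdom : Integrable (fun p : K × (ι → K) => ‖g p.1‖ *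
        (M * (piPrimePowBall K ι n₀).indicator (levelWeight μ ℓ) p.2)) (μ.prod (Measure.pi fun _ : ι => μ)) :=
      hgi.norm.mul_prod (((integrableOn_levelWeight μ hι ℓ n₀).integrable_indicator
        (measurableSet_piPrimePowBall' n₀)).const_mul M)
    refine hdom.mono' ((hgc.measurable.comp measurable_fst).aestronglyMeasurable.mul hsDm)
      ?_
    filter_upwards [hae2] with p hp0
    rw [norm_mul]
    exact mul_le_mul_of_nonneg_left (norm_sliceDensity_le_levelWeight μ hinv hsupp hA hΦm hp0 p.1) (norm_nonneg _)
  have hR : ∫ b, g b * fibreDensity μ Φ b ∂μ = ∫ b, ∫ x, g b * sD x b ∂(Measure.pi fun _ : ι => μ) ∂μ := by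
    refine integral_congr_ae (Eventually.of_forall fun b => ?_)
    simp only [fibreDensity, hsD]
    rw [integral_const_mul]
  rw [hR]
  conv_rhs => rw [integral_integral_swap hWi]
  -- (4) slice disintegration, a.e. in `x`
  have hae : ∀ᵐ x ∂(Measure.pi fun _ : ι => μ), x ≠ (0 : ι → K) := by
    have h := measure_eq_zero_iff_ae_notMem.1 (measure_pi_singleton_zero (ι := ι) μ)
    filter_upwards [h] with x hx using fun h0 => hx (h0 ▸ Set.mem_singleton _)
  refine integral_congr_ae ?_
  filter_upwards [hae] with x hx0
  exact (integral_mul_sliceDensity μ hinv hsupp hA hΦm hg hx0).symm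

/-! ### The cone `x ⬝ᵥ y = 0` has positive density (`U(0)_v ≠ ∅` at a split place) -/

omit [MeasurableSpace K] [BorelSpace K] in
/-- the indicator of a product of boxes is Schwartz–Bruhat on `K^ι × K^ι`. [cite: WeilBNT1967, Ch. VII §2, Prop. 2] -/
theorem indicator_box_prod_box_mem_schwartzBruhat (n : ℤ) :
    (piPrimePowBall K ι n ×ˢ piPrimePowBall K ι n).indicator (fun _ => (1 : ℂ)) ∈
      SchwartzBruhat ((ι → K) × (ι → K)) := by
  rw [mem_schwartzBruhat_iff]
  have hopen : IsOpen (piPrimePowBall K ι n ×ˢ piPrimePowBall K ι n) :=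
    (isOpen_piPrimePowBall n).prod (isOpen_piPrimePowBall n)
  have hclosed : IsClosed (piPrimePowBall K ι n ×ˢ piPrimePowBall K ι n) :=
    (isClosed_piPrimePowBall n).prod (isClosed_piPrimePowBall n)
  refine ⟨?_, HasCompactSupport.intro' ((isCompact_piPrimePowBall n).prod (isCompact_piPrimePowBall n)) hclosed
    fun z hz => Set.indicator_of_notMem hz _⟩
  rw [IsLocallyConstant.iff_exists_open]
  intro z
  by_cases hz : z ∈ piPrimePowBall K ι n ×ˢ piPrimePowBall K ι n
  · exact ⟨_, hopen, hz, fun w hw => by rw [Set.indicator_of_mem hw, Set.indicator_of_mem hz]⟩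
  · exact ⟨_, hclosed.isOpen_compl, hz, fun w hw => by
      rw [Set.indicator_of_notMem hw, Set.indicator_of_notMem hz]⟩

/-- the slice density of `𝟙_{𝒪^ι × 𝒪^ι}` at the cone value `b = 0` and a point `x ∈ 𝒪^ι ∖ 0`: EXACTLY
`μ^ι(𝒪^ι) / μ(𝔭^{level x})` (every `y ∈ 𝒪^ι` has `x ⬝ᵥ y ∈ 𝔭^{level x}`, so the slab at radius `level x` is all of
`𝒪^ι`). [cite: Weil1965, Chap. V n° 50 (40), p. 74] -/
theorem sliceDensity_indicator_zero [Nonempty ι] [DecidableEq ι] {x : ι → K} (hx0 : x ≠ 0)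
    (hx : x ∈ piPrimePowBall K ι 0) :
    sliceDensity μ x (fun y => (piPrimePowBall K ι 0 ×ˢ piPrimePowBall K ι 0).indicator (fun _ => (1 : ℂ)) (x, y)) 0 =
      (μ.real (primePowBall K (level x)) : ℂ)⁻¹ *
        ((Measure.pi fun _ : ι => μ).real (piPrimePowBall K ι 0) : ℂ) := by
  haveI : SecondCountableTopology K := secondCountable'
  haveI := sigmaFinite_haarA2 μ
  set Φ₀ : (ι → K) × (ι → K) → ℂ := (piPrimePowBall K ι 0 ×ˢ piPrimePowBall K ι 0).indicator (fun _ => (1 : ℂ))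
    with hΦ₀
  -- the slice is the indicator of `𝒪^ι`
  have hslice : (fun y => Φ₀ (x, y)) = (piPrimePowBall K ι 0).indicator (fun _ => (1 : ℂ)) := by
    funext y
    by_cases hy : y ∈ piPrimePowBall K ι 0
    · rw [hΦ₀, Set.indicator_of_mem (Set.mk_mem_prod hx hy), Set.indicator_of_mem hy]
    · rw [hΦ₀, Set.indicator_of_notMem (fun h => hy h.2), Set.indicator_of_notMem hy]
  have hinv : ∀ y, ∀ t ∈ piPrimePowBall K ι 0, (fun y => Φ₀ (x, y)) (y + t) = (fun y => Φ₀ (x, y)) y := by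
    intro y t ht
    rw [hslice]
    by_cases hy : y ∈ piPrimePowBall K ι 0
    · rw [Set.indicator_of_mem hy, Set.indicator_of_mem (add_mem_piPrimePowBall hy ht)]
    · have hyt : y + t ∉ piPrimePowBall K ι 0 := fun h => hy (by
        have := add_mem_piPrimePowBall h (neg_mem_piPrimePowBall ht); rwa [add_neg_cancel_right] at this)
      rw [Set.indicator_of_notMem hy, Set.indicator_of_notMem hyt]
  have hint : Integrable (fun y => Φ₀ (x, y)) (Measure.pi fun _ : ι => μ) := by
    rw [hslice]
    exact (integrable_indicator_iff (measurableSet_piPrimePowBall' 0)).2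
      ((integrableOn_const_iff (C := (1 : ℂ))).2 (Or.inr (measure_pi_piPrimePowBall_lt_top μ 0)))
  have hxs := mem_shell_level hx0
  rw [sliceDensity_eq μ hxs hinv hint, zero_add]
  congr 1
  -- the slab integral at radius `level x` over `𝒪^ι` is the whole measure of `𝒪^ι`
  rw [sliceIntegral]
  have hone : ∀ y, ((0 : K) +ᵥ primePowBall K (level x)).indicator (1 : K → ℂ) (x ⬝ᵥ y) * Φ₀ (x, y) =
      (piPrimePowBall K ι 0).indicator (fun _ => (1 : ℂ)) y := by
    intro y
    rw [show Φ₀ (x, y) = (piPrimePowBall K ι 0).indicator (fun _ => (1 : ℂ)) y from congrFun hslice y]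
    by_cases hy : y ∈ piPrimePowBall K ι 0
    · have hxy : x ⬝ᵥ y ∈ (0 : K) +ᵥ primePowBall K (level x) := by
        rw [mem_vadd_primePowBall_iff, sub_zero]
        simpa using dotProduct_mem_primePowBall_of_mem hxs.1 hy
      rw [Set.indicator_of_mem hxy, Pi.one_apply, one_mul]
    · rw [Set.indicator_of_notMem hy, mul_zero]
  simp_rw [hone]
  rw [integral_indicator_const _ (measurableSet_piPrimePowBall' 0), Complex.real_smul, mul_one]

/-- **THE CONE HAS POSITIVE FIBRE DENSITY** (`U(0)_v ≠ ∅` at a split place, the last input of Weil's one-place argument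
[Weil1965, Chap. V n° 50, end of the proof of Thm 4, p. 74: "on peut donc choisir `Φ_v` de manière que `μ_v(0)` ne soit
pas nul"]): for `Φ₀ = 𝟙_{𝒪^ι × 𝒪^ι}` and `|ι| ≥ 2`,
`Re F_{Φ₀}(0) ≥ μ^ι(𝒪^ι)² / μ(𝒪) > 0` (indeed `F_{Φ₀}(0) = (1 - q^{-|ι|})/(1 - q^{1-|ι|}) · μ(𝒪)^{2|ι| - 1}`).
[cite: Weil1965, Chap. V n° 50 Thm 4, p. 72] -/
theorem re_fibreDensity_indicator_zero_pos [Nonempty ι] [DecidableEq ι] [MeasurableSingletonClass K]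
    (hι : 2 ≤ Fintype.card ι) :
    0 < (fibreDensity μ ((piPrimePowBall K ι 0 ×ˢ piPrimePowBall K ι 0).indicator (fun _ => (1 : ℂ))) 0).re := by
  haveI : SecondCountableTopology K := secondCountable'
  haveI := sigmaFinite_haarA2 μ
  set Φ₀ : (ι → K) × (ι → K) → ℂ := (piPrimePowBall K ι 0 ×ˢ piPrimePowBall K ι 0).indicator (fun _ => (1 : ℂ))
    with hΦ₀
  obtain ⟨ℓ, n₀, A, hinv, hsupp, hA⟩ := exists_structure_of_mem_schwartzBruhat (indicator_box_prod_box_mem_schwartzBruhat (K := K) (ι := ι) 0)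
  have hΦm : Measurable Φ₀ := measurable_of_mem_schwartzBruhat (indicator_box_prod_box_mem_schwartzBruhat 0)
  have hint : Integrable (fun x => sliceDensity μ x (fun y => Φ₀ (x, y)) 0) (Measure.pi fun _ : ι => μ) :=
    integrable_sliceDensity μ hι hinv hsupp hA hΦm 0
  -- pointwise lower bound of the real part by `c · 𝟙_{𝒪^ι}`, `c = μ^ι(𝒪^ι)/μ(𝒪)`
  set c : ℝ := (μ.real (primePowBall K 0))⁻¹ * (Measure.pi fun _ : ι => μ).real (piPrimePowBall K ι 0) with hc
  have hcpos : 0 < c := mul_pos (inv_pos.2 (measureReal_primePowBall_pos μ 0)) (measureReal_piPrimePowBall_pos _ 0)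
  have hae : ∀ᵐ x ∂(Measure.pi fun _ : ι => μ), x ≠ (0 : ι → K) := by
    have h := measure_eq_zero_iff_ae_notMem.1 (measure_pi_singleton_zero (ι := ι) μ)
    filter_upwards [h] with x hx using fun h0 => hx (h0 ▸ Set.mem_singleton _)
  have hlow : ∀ᵐ x ∂(Measure.pi fun _ : ι => μ),
      (piPrimePowBall K ι 0).indicator (fun _ => c) x ≤ (sliceDensity μ x (fun y => Φ₀ (x, y)) 0).re := by
    filter_upwards [hae] with x hx0
    by_cases hx : x ∈ piPrimePowBall K ι 0
    · rw [Set.indicator_of_mem hx, hΦ₀, sliceDensity_indicator_zero μ hx0 hx, ← Complex.ofReal_inv,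
        ← Complex.ofReal_mul, Complex.ofReal_re, hc]
      refine mul_le_mul_of_nonneg_right ?_ measureReal_nonneg
      exact inv_anti₀ (measureReal_primePowBall_pos μ _) (measureReal_mono
        (primePowBall_antitone (le_level_of_mem hx0 hx)) (measure_primePowBall_lt_top μ 0).ne)
    · have h0 : (fun y => Φ₀ (x, y)) = fun _ => 0 := funext fun y => by
        rw [hΦ₀, Set.indicator_of_notMem (fun h => hx h.1)]
      rw [Set.indicator_of_notMem hx, h0, sliceDensity_zero_fun, Complex.zero_re]
  have hre : (fibreDensity μ Φ₀ 0).re = ∫ x, (sliceDensity μ x (fun y => Φ₀ (x, y)) 0).re ∂(Measure.pi fun _ : ι => μ) := by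
    have h := integral_re hint
    simp only [RCLike.re_to_complex] at h
    rw [fibreDensity, ← h]
  rw [hre]
  calc (0 : ℝ) < c * (Measure.pi fun _ : ι => μ).real (piPrimePowBall K ι 0) :=
        mul_pos hcpos (measureReal_piPrimePowBall_pos _ 0)
    _ = ∫ x, (piPrimePowBall K ι 0).indicator (fun _ => c) x ∂(Measure.pi fun _ : ι => μ) := by
        rw [integral_indicator_const _ (measurableSet_piPrimePowBall' 0), smul_eq_mul, mul_comm]
    _ ≤ ∫ x, (sliceDensity μ x (fun y => Φ₀ (x, y)) 0).re ∂(Measure.pi fun _ : ι => μ) :=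
        integral_mono_ae ((integrable_indicator_iff (measurableSet_piPrimePowBall' 0)).2
          ((integrableOn_const_iff (C := c)).2 (Or.inr (measure_pi_piPrimePowBall_lt_top μ 0)))) hint.re hlow

/-- in particular `F_{𝟙_{𝒪^ι × 𝒪^ι}}(0) ≠ 0`. [cite: Weil1965, Chap. V n° 50 Thm 4, p. 72] -/
theorem fibreDensity_indicator_zero_ne_zero [Nonempty ι] [DecidableEq ι] [MeasurableSingletonClass K]
    (hι : 2 ≤ Fintype.card ι) :
    fibreDensity μ ((piPrimePowBall K ι 0 ×ˢ piPrimePowBall K ι 0).indicator (fun _ => (1 : ℂ))) 0 ≠ 0 := by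
  intro h
  have := re_fibreDensity_indicator_zero_pos μ hι (K := K) (ι := ι)
  rw [h, Complex.zero_re] at this
  exact lt_irrefl 0 this

end FibreDensity

end Literature.NumberTheory.Weil1965.SplitPlace
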